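import Literature.NumberTheory.QuadraticFields.ThreeTorsion
import Mathlib.Analysis.SpecialFunctions.Pow.Real
import Mathlib.Analysis.SpecialFunctions.Trigonometric.Basic
import HarnessLib

/-!
# Davenport–Heilbronn: the mean of `#Cl₃(D)` over quadratic fields, with power saving and in arithmetic progressions (named facts)

Cite item `wi-10114` (route `QuantumAdvantage/ArithStatLadder`, items `EndJuntaRung`
`stmt-QuantumAdvantage-2426` and the in-print ends of `DigitRung` `stmt-QuantumAdvantage-2423`).
Four results IN PRINT on `t(D) = #Cl(ℚ(√D))[3]` — the tree's total function
`quadFieldThreeTorsion : ℤ → ℕ` (`ThreeTorsion.lean`; `= #Cl(K)[3]` for every quadratic field `K` of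
discriminant `D`, `quadFieldThreeTorsion_eq`) — summed over FUNDAMENTAL discriminants
(spelled out as in `FundamentalDiscriminant.lean` / `ThreeTorsion.lean` / the route:
`D ≡ 1 (4)` squarefree `≠ 1`, or `D = 4d`, `d ≡ 2, 3 (4)` squarefree; the finsets `negFundDiscrs X`,
`posFundDiscrs X` below), vendored as named facts `def … : Prop` (CONVENTIONS §4):

* `bst_threeTorsion_mean` (halves `.neg`, `.pos`) — Davenport–Heilbronn (1971, Thm 3) in the form
  of Bhargava–Shankar–Tsimerman, Cor. 7: `Σ_{-X<D<0} #Cl₃(D) / Σ_{-X<D<0} 1 → 2` and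
  `Σ_{0<D<X} #Cl₃(D) / Σ_{0<D<X} 1 → 4/3` (`X → ∞`).
* `btt_threeTorsion_sum` (halves `.neg`, `.pos`) — the two-term asymptotic with power saving,
  Bhargava–Taniguchi–Thorne 2023, Thm 1.2 (Taniguchi–Thorne 2013, Thm 2 had `O(X^{18/23+ε})`): `Σ_{0<±D<X} #Cl₃(D) = (3+C^±)/π² · X + K^± c X^{5/6} + O_ε(X^{2/3+ε})`,
  `C⁻ = 3`, `C⁺ = 1` (so `6/π²`, `4/π²`), `K⁻ = √3`, `K⁺ = 1`,
  `c = 8ζ(1/3)/(5Γ(2/3)³) · Π_p (1 - (p^{1/3}+1)/(p(p+1)))`. Rendered with the secondary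
  coefficient EXISTENTIALLY quantified (`∃ K : ℝ`; the printed closed form is recorded here only)
  — weaker than print, and what consumers use.
* `tt_threeTorsion_sum_progression` (halves `.neg`, `.pos`) — Taniguchi–Thorne 2013 (Duke), Thm 6:
  for `(6a, m) = 1`, `Σ_{0<±D<X, D ≡ a (m)} #Cl₃(D) = (3+C^±)/(π² m) · Π_{p∣m} (1-p⁻²)⁻¹ · X
  + (8K^±/(5Γ(2/3)³)) K'₁(m,a) X^{5/6} + O(X^{18/23} m^{20/23})`; rendered per `(m, a)` with the
  secondary coefficient existential and error `O_{m,a,ε}(X^{18/23+ε})` (weaker than print).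
* `tt_count_quadraticFields_progression` — Taniguchi–Thorne 2013 (Duke), Lemma 21 (count of
  quadratic fields, i.e. fundamental discriminants, in an arithmetic progression `a (mod m)`,
  `2⁶ ∣ m`): `(8/(π² m)) e(a,2) Π_{p>2, pᵏ∥m} e(a,pᵏ)(1-p⁻²)⁻¹ · X + O(√X)` for each sign, with the
  printed local factors `e` (`ttLocalFactorTwo`, `ttLocalFactorOdd`).

What is NOT here (and is NOT in print as such): the mean of `#Cl₃` in classes `a (mod 2ᵏ)`,
`k ≥ 3` — the case route `ArithStatLadder` needs for binary digits. Taniguchi–Thorne treat general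
progressions only through their general twisted theorem (Duke Thm 25: local specifications +
Dirichlet-character twists; characters `χ` with `χ⁶ ≠ 1` contribute `O(X^{18/23+ε} N^{20/23})`)
and write "we could deduce other variations as well" (§6.6) / "when `4 ∣ m` … we treat this case
as well" (CJM companion, after Thm 1.5); Bhargava–Shankar–Tsimerman, Thm 20 counts binary cubic
forms under congruence conditions `mod m`. The deduction for `m = 2ᵏ` (orthogonality over
characters `mod 2ᵏ`, reduction of quadratic characters to local specifications at `2`, and the
`2`-adic mass computation giving mean exactly `2` in every class) is bookkeeping left to the
consumer; its printed input beyond this file (TT Thm 25 in full generality) needs the notion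
"cubic field with prescribed completion at `p`", not yet in the tree.

## References

* H. Davenport, H. Heilbronn, *On the density of discriminants of cubic fields. II*,
  Proc. Roy. Soc. London A 322 (1971) 405–420, Thm 3 [DavenportHeilbronn1971].
* M. Bhargava, A. Shankar, J. Tsimerman, *On the Davenport–Heilbronn theorems and second order
  terms*, Invent. Math. 193 (2013) 439–499 = arXiv:1005.0672 (read: Cor. 7 p. 3, Thm 20 §5.5,
  §8.5) [BhargavaShankarTsimerman2012].
* T. Taniguchi, F. Thorne, *Secondary terms in counting functions for cubic fields*, Duke Math. J.
  162 (2013) 2451–2508 = arXiv:1102.2914 (read: Thms 2, 4, 6, Lemma 21, Thm 25, §§6.3–6.6)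
  [TaniguchiThorne2013]; companion *Orbital L-functions for the space of binary cubic forms*,
  Canad. J. Math. 65 (2013) = arXiv:1112.5030, Thms 1.4–1.5 [TaniguchiThorne2013Orbital].
* M. Bhargava, T. Taniguchi, F. Thorne, *Improved error estimates for the Davenport–Heilbronn
  theorems*, Math. Ann. 389 (2024) = arXiv:2107.12819, Thm 1.2 (read, p. 3) [BhargavaTaniguchiThorne2023].
-/

noncomputable section

open Finset Filter
open scoped Topology

namespace Literature.NumberTheory.QuadraticFields

/-! ### The finsets of fundamental discriminants in `(-X, 0)` and `(0, X)` -/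

/-- Decidability of "`D` is squarefree" on `ℤ`, through `Int.squarefree_natAbs`. [folklore] -/
instance instDecidablePredSquarefreeInt : DecidablePred (Squarefree : ℤ → Prop) := fun _ =>
  decidable_of_iff _ Int.squarefree_natAbs

/-- The negative fundamental discriminants `D` with `-X < D < 0` (`D ≡ 1 (mod 4)` squarefree, or
`D = 4d` with `d ≡ 2, 3 (mod 4)` squarefree — the spelling of `FundamentalDiscriminant.lean`), i.e.
the discriminants of the imaginary quadratic fields with `|D| < X`. [folklore] -/
def negFundDiscrs (X : ℕ) : Finset ℤ :=
  (Finset.Ioo (-(X : ℤ)) 0).filter fun D =>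
    (D % 4 = 1 ∧ Squarefree D ∧ D ≠ 1) ∨ (4 ∣ D ∧ (D / 4 % 4 = 2 ∨ D / 4 % 4 = 3) ∧ Squarefree (D / 4))

/-- The positive fundamental discriminants `D` with `0 < D < X`, i.e. the discriminants of the real
quadratic fields with `D < X`. [folklore] -/
def posFundDiscrs (X : ℕ) : Finset ℤ :=
  (Finset.Ioo (0 : ℤ) X).filter fun D =>
    (D % 4 = 1 ∧ Squarefree D ∧ D ≠ 1) ∨ (4 ∣ D ∧ (D / 4 % 4 = 2 ∨ D / 4 % 4 = 3) ∧ Squarefree (D / 4))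

/-- Membership in `negFundDiscrs X`, unfolded. [folklore] -/
theorem mem_negFundDiscrs {X : ℕ} {D : ℤ} : D ∈ negFundDiscrs X ↔
    (-(X : ℤ) < D ∧ D < 0) ∧ ((D % 4 = 1 ∧ Squarefree D ∧ D ≠ 1) ∨
      (4 ∣ D ∧ (D / 4 % 4 = 2 ∨ D / 4 % 4 = 3) ∧ Squarefree (D / 4))) := by
  simp [negFundDiscrs]

/-- Membership in `posFundDiscrs X`, unfolded. [folklore] -/
theorem mem_posFundDiscrs {X : ℕ} {D : ℤ} : D ∈ posFundDiscrs X ↔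
    (0 < D ∧ D < X) ∧ ((D % 4 = 1 ∧ Squarefree D ∧ D ≠ 1) ∨
      (4 ∣ D ∧ (D / 4 % 4 = 2 ∨ D / 4 % 4 = 3) ∧ Squarefree (D / 4))) := by
  simp [posFundDiscrs]

/-- `-3 ∈ negFundDiscrs 4`: the sets are not empty (sanity check of the spelling: `-3 % 4 = 1` in
`ℤ`). [folklore] -/
example : (-3 : ℤ) ∈ negFundDiscrs 4 := by
  rw [mem_negFundDiscrs]
  refine ⟨by norm_num, Or.inl ⟨by decide, ?_, by norm_num⟩⟩
  rw [← Int.squarefree_natAbs]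
  exact Nat.prime_three.prime.squarefree

/-! ### Davenport–Heilbronn: the mean is `2` (imaginary) and `4/3` (real) -/

/-- **Davenport–Heilbronn / Bhargava–Shankar–Tsimerman, Cor. 7** (as printed: "`lim_{X→∞}
Σ_{0<D<X} #Cl₃(D) / Σ_{0<D<X} 1 = 4/3`, `lim_{X→∞} Σ_{-X<D<0} #Cl₃(D) / Σ_{-X<D<0} 1 = 2`", `D`
ranging over discriminants of quadratic fields; Davenport–Heilbronn 1971, Thm 3). Here along
`X ∈ ℕ`, with `#Cl₃(D) = quadFieldThreeTorsion D`; first conjunct imaginary (`2`), second real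
(`4/3`). [cite: BhargavaShankarTsimerman2012, Cor. 7] -/
def bst_threeTorsion_mean : Prop :=
  Tendsto (fun X : ℕ =>
      (∑ D ∈ negFundDiscrs X, (quadFieldThreeTorsion D : ℝ)) / ((negFundDiscrs X).card : ℝ))
    atTop (𝓝 2) ∧
  Tendsto (fun X : ℕ =>
      (∑ D ∈ posFundDiscrs X, (quadFieldThreeTorsion D : ℝ)) / ((posFundDiscrs X).card : ℝ))
    atTop (𝓝 (4 / 3))

/-- The imaginary half of `bst_threeTorsion_mean`: the mean of `#Cl₃` over `-X < D < 0` tends to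
`2`. [cite: BhargavaShankarTsimerman2012, Cor. 7] -/
theorem bst_threeTorsion_mean.neg (h : bst_threeTorsion_mean) :
    Tendsto (fun X : ℕ =>
      (∑ D ∈ negFundDiscrs X, (quadFieldThreeTorsion D : ℝ)) / ((negFundDiscrs X).card : ℝ))
    atTop (𝓝 2) :=
  h.1

/-- The real half of `bst_threeTorsion_mean`: the mean of `#Cl₃` over `0 < D < X` tends to `4/3`.
[cite: BhargavaShankarTsimerman2012, Cor. 7] -/
theorem bst_threeTorsion_mean.pos (h : bst_threeTorsion_mean) :
    Tendsto (fun X : ℕ =>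
      (∑ D ∈ posFundDiscrs X, (quadFieldThreeTorsion D : ℝ)) / ((posFundDiscrs X).card : ℝ))
    atTop (𝓝 (4 / 3)) :=
  h.2

/-! ### Two-term asymptotics with power saving -/

/-- **Bhargava–Taniguchi–Thorne 2023, Thm 1.2** (both signs; secondary coefficients existential):
there are `K⁻, K⁺ ∈ ℝ` (in print `K^± · 8ζ(1/3)/(5Γ(2/3)³) · Π_p (1 - (p^{1/3}+1)/(p(p+1)))`,
`K⁻ = √3`, `K⁺ = 1`) such that for every `ε > 0`,
`Σ_{-X<D<0} #Cl₃(D) = (6/π²) X + K⁻ X^{5/6} + O_ε(X^{2/3+ε})` and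
`Σ_{0<D<X} #Cl₃(D) = (4/π²) X + K⁺ X^{5/6} + O_ε(X^{2/3+ε})` (`(3 + C^±)/π²`, `C⁻ = 3`, `C⁺ = 1`;
Taniguchi–Thorne 2013 Thm 2 had `O(X^{18/23+ε})`; main terms Davenport–Heilbronn).
[cite: BhargavaTaniguchiThorne2023, Theorem 1.2] -/
def btt_threeTorsion_sum : Prop :=
  (∃ K : ℝ, ∀ ε : ℝ, 0 < ε → ∃ C : ℝ, ∀ X : ℕ, 1 ≤ X →
    |(∑ D ∈ negFundDiscrs X, (quadFieldThreeTorsion D : ℝ)) - 6 / Real.pi ^ 2 * X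
        - K * (X : ℝ) ^ ((5 : ℝ) / 6)| ≤ C * (X : ℝ) ^ ((2 : ℝ) / 3 + ε)) ∧
  (∃ K : ℝ, ∀ ε : ℝ, 0 < ε → ∃ C : ℝ, ∀ X : ℕ, 1 ≤ X →
    |(∑ D ∈ posFundDiscrs X, (quadFieldThreeTorsion D : ℝ)) - 4 / Real.pi ^ 2 * X
        - K * (X : ℝ) ^ ((5 : ℝ) / 6)| ≤ C * (X : ℝ) ^ ((2 : ℝ) / 3 + ε))

/-- The imaginary half of `btt_threeTorsion_sum`:
`Σ_{-X<D<0} #Cl₃(D) = (6/π²) X + K X^{5/6} + O_ε(X^{2/3+ε})`. [cite: BhargavaTaniguchiThorne2023, Theorem 1.2] -/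
theorem btt_threeTorsion_sum.neg (h : btt_threeTorsion_sum) :
    ∃ K : ℝ, ∀ ε : ℝ, 0 < ε → ∃ C : ℝ, ∀ X : ℕ, 1 ≤ X →
      |(∑ D ∈ negFundDiscrs X, (quadFieldThreeTorsion D : ℝ)) - 6 / Real.pi ^ 2 * X
          - K * (X : ℝ) ^ ((5 : ℝ) / 6)| ≤ C * (X : ℝ) ^ ((2 : ℝ) / 3 + ε) :=
  h.1

/-- The real half of `btt_threeTorsion_sum`:
`Σ_{0<D<X} #Cl₃(D) = (4/π²) X + K X^{5/6} + O_ε(X^{2/3+ε})`. [cite: BhargavaTaniguchiThorne2023, Theorem 1.2] -/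
theorem btt_threeTorsion_sum.pos (h : btt_threeTorsion_sum) :
    ∃ K : ℝ, ∀ ε : ℝ, 0 < ε → ∃ C : ℝ, ∀ X : ℕ, 1 ≤ X →
      |(∑ D ∈ posFundDiscrs X, (quadFieldThreeTorsion D : ℝ)) - 4 / Real.pi ^ 2 * X
          - K * (X : ℝ) ^ ((5 : ℝ) / 6)| ≤ C * (X : ℝ) ^ ((2 : ℝ) / 3 + ε) :=
  h.2

/-! ### Arithmetic progressions `a (mod m)` with `(6a, m) = 1` -/

/-- **Taniguchi–Thorne 2013 (Duke), Thm 6** (both signs). For `m ≥ 1` and `a` with `(6a, m) = 1`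
there are `K⁻ = K⁻(m, a)`, `K⁺ = K⁺(m, a) ∈ ℝ` (in print `(8K^±/(5Γ(2/3)³)) K'₁(m,a)`, an explicit
sum over sextic characters) such that for every `ε > 0`,
`Σ_{-X<D<0, D ≡ a (m)} #Cl₃(D) = (6/(π² m)) Π_{p ∣ m} (1 - p⁻²)⁻¹ · X + K⁻ X^{5/6} + O(X^{18/23+ε})`
and `Σ_{0<D<X, D ≡ a (m)} #Cl₃(D) = (4/(π² m)) Π_{p ∣ m} (1 - p⁻²)⁻¹ · X + K⁺ X^{5/6} + O(X^{18/23+ε})`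
(`(3 + C^±)/(π² m)`; print: `O(X^{18/23} m^{20/23})`, uniform in `m`; here the constants are per
`(m, a, ε)` — weaker). [cite: TaniguchiThorne2013, Theorem 6] -/
def tt_threeTorsion_sum_progression : Prop :=
  ∀ (m : ℕ) (a : ℤ), 1 ≤ m → Int.gcd (6 * a) m = 1 →
    (∃ K : ℝ, ∀ ε : ℝ, 0 < ε → ∃ C : ℝ, ∀ X : ℕ, 1 ≤ X →
      |(∑ D ∈ (negFundDiscrs X).filter (fun D => D ≡ a [ZMOD m]), (quadFieldThreeTorsion D : ℝ))
          - 6 / (Real.pi ^ 2 * m) * (∏ p ∈ m.primeFactors, (1 - 1 / (p : ℝ) ^ 2)⁻¹) * X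
          - K * (X : ℝ) ^ ((5 : ℝ) / 6)| ≤ C * (X : ℝ) ^ ((18 : ℝ) / 23 + ε)) ∧
    (∃ K : ℝ, ∀ ε : ℝ, 0 < ε → ∃ C : ℝ, ∀ X : ℕ, 1 ≤ X →
      |(∑ D ∈ (posFundDiscrs X).filter (fun D => D ≡ a [ZMOD m]), (quadFieldThreeTorsion D : ℝ))
          - 4 / (Real.pi ^ 2 * m) * (∏ p ∈ m.primeFactors, (1 - 1 / (p : ℝ) ^ 2)⁻¹) * X
          - K * (X : ℝ) ^ ((5 : ℝ) / 6)| ≤ C * (X : ℝ) ^ ((18 : ℝ) / 23 + ε))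

/-- The imaginary half of `tt_threeTorsion_sum_progression` at `(m, a)`.
[cite: TaniguchiThorne2013, Theorem 6] -/
theorem tt_threeTorsion_sum_progression.neg (h : tt_threeTorsion_sum_progression) {m : ℕ} {a : ℤ}
    (hm : 1 ≤ m) (ha : Int.gcd (6 * a) m = 1) :
    ∃ K : ℝ, ∀ ε : ℝ, 0 < ε → ∃ C : ℝ, ∀ X : ℕ, 1 ≤ X →
      |(∑ D ∈ (negFundDiscrs X).filter (fun D => D ≡ a [ZMOD m]), (quadFieldThreeTorsion D : ℝ))
          - 6 / (Real.pi ^ 2 * m) * (∏ p ∈ m.primeFactors, (1 - 1 / (p : ℝ) ^ 2)⁻¹) * X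
          - K * (X : ℝ) ^ ((5 : ℝ) / 6)| ≤ C * (X : ℝ) ^ ((18 : ℝ) / 23 + ε) :=
  (h m a hm ha).1

/-- The real half of `tt_threeTorsion_sum_progression` at `(m, a)`.
[cite: TaniguchiThorne2013, Theorem 6] -/
theorem tt_threeTorsion_sum_progression.pos (h : tt_threeTorsion_sum_progression) {m : ℕ} {a : ℤ}
    (hm : 1 ≤ m) (ha : Int.gcd (6 * a) m = 1) :
    ∃ K : ℝ, ∀ ε : ℝ, 0 < ε → ∃ C : ℝ, ∀ X : ℕ, 1 ≤ X →
      |(∑ D ∈ (posFundDiscrs X).filter (fun D => D ≡ a [ZMOD m]), (quadFieldThreeTorsion D : ℝ))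
          - 4 / (Real.pi ^ 2 * m) * (∏ p ∈ m.primeFactors, (1 - 1 / (p : ℝ) ^ 2)⁻¹) * X
          - K * (X : ℝ) ^ ((5 : ℝ) / 6)| ≤ C * (X : ℝ) ^ ((18 : ℝ) / 23 + ε) :=
  (h m a hm ha).2

/-! ### Counting quadratic fields in an arithmetic progression (Taniguchi–Thorne, Lemma 21) -/

/-- The local factor `e(a, 2)` of Taniguchi–Thorne, Lemma 21: `1` if `a ≡ 1 (mod 4)`, `1` if
`a ≡ 8, 12 (mod 16)`, `0` otherwise. [cite: TaniguchiThorne2013, Lemma 21] -/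
def ttLocalFactorTwo (a : ℤ) : ℝ :=
  if a % 4 = 1 ∨ a % 16 = 8 ∨ a % 16 = 12 then 1 else 0

/-- The local factor `e(a, pᵏ)` (`p ≠ 2`, `pᵏ ∥ m`, `k ≥ 1`) of Taniguchi–Thorne, Lemma 21: `1` if
`p ∤ a`; `1` if `k ≥ 2` and `p² ∤ a`; `1 - 1/p` if `k = 1` and `p ∣ a`; `0` otherwise.
[cite: TaniguchiThorne2013, Lemma 21] -/
def ttLocalFactorOdd (p k : ℕ) (a : ℤ) : ℝ :=
  if ¬ (p : ℤ) ∣ a then 1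
  else if 2 ≤ k ∧ ¬ (p : ℤ) ^ 2 ∣ a then 1
  else if k = 1 then 1 - 1 / (p : ℝ)
  else 0

/-- The main-term constant of Taniguchi–Thorne, Lemma 21:
`c(m, a) = (8/(π² m)) · e(a, 2) · Π_{p > 2, pᵏ ∥ m} e(a, pᵏ) (1 - p⁻²)⁻¹`.
[cite: TaniguchiThorne2013, Lemma 21] -/
def ttQuadraticFieldsDensity (m : ℕ) (a : ℤ) : ℝ :=
  8 / (Real.pi ^ 2 * m) * ttLocalFactorTwo a *
    ∏ p ∈ m.primeFactors.erase 2, ttLocalFactorOdd p (m.factorization p) a * (1 - 1 / (p : ℝ) ^ 2)⁻¹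

/-- **Taniguchi–Thorne 2013 (Duke), Lemma 21** (as printed; "a relatively straightforward
generalization of Tenenbaum, I.3.7, Thm 9", proof omitted there): assume `2⁶ ∣ m`; then for each
choice of sign the number of quadratic fields `F` with `0 < ±Disc(F) < X` and `Disc(F) ≡ a (mod m)`
— i.e. of fundamental discriminants in that range and class — equals `c(m, a) X + O(√X)` with
`c(m, a) = ttQuadraticFieldsDensity m a`. Implied constant here per `(m, a)`.
[cite: TaniguchiThorne2013, Lemma 21] -/
def tt_count_quadraticFields_progression : Prop :=
  ∀ (m : ℕ) (a : ℤ), 64 ∣ m → ∃ C : ℝ, ∀ X : ℕ, 1 ≤ X →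
    |(((negFundDiscrs X).filter (fun D => D ≡ a [ZMOD m])).card : ℝ)
        - ttQuadraticFieldsDensity m a * X| ≤ C * Real.sqrt X ∧
    |(((posFundDiscrs X).filter (fun D => D ≡ a [ZMOD m])).card : ℝ)
        - ttQuadraticFieldsDensity m a * X| ≤ C * Real.sqrt X

/-! ### Sanity lemmas -/

/-- The density constant vanishes on classes containing no fundamental discriminant at `2`
(e.g. `a ≡ 3 (mod 4)`): `e(3, 2) = 0`. [folklore] -/
example : ttLocalFactorTwo 3 = 0 := by
  simp [ttLocalFactorTwo]

/-- `e(1, 2) = 1`. [folklore] -/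
example : ttLocalFactorTwo 1 = 1 := by
  simp [ttLocalFactorTwo]

/-- For `p ∤ a` the odd local factor is `1`. [folklore] -/
theorem ttLocalFactorOdd_of_not_dvd {p k : ℕ} {a : ℤ} (h : ¬ (p : ℤ) ∣ a) :
    ttLocalFactorOdd p k a = 1 := by
  simp [ttLocalFactorOdd, h]

/-! ### Fact decomposition of `bst_threeTorsion_mean` (librarian `fact-decompose`, 2026-08-16)

The printed proof of Cor. 7 (Bhargava–Shankar–Tsimerman, §8.5, verbatim in outline): by class field
theory `Σ_{0<±Disc(K₂)<X} (h₃*(K₂) − 1)/2 = N(𝒱 ∩ V^{(i)}; X)`, the number of nowhere totally ramified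
cubic fields of the given sign of discriminant below `X`; by the Davenport–Heilbronn count with the
sieve of §8.2–8.3, `lim N(𝒱 ∩ V^{(i)}; X)/X = (π²/(12 nᵢ)) Π_p (1 − p⁻²)² = 3/(nᵢ π²)` (`n₀ = 6` for
`D > 0`, `n₁ = 2` for `D < 0`); and "since it is known that `lim Σ_{0<Disc(K₂)<X} 1 / X = 3/π²`,
`lim Σ_{-X<Disc(K₂)<0} 1 / X = 3/π²`, we conclude" the two limits `1 + (2·3/(6π²))/(3/π²) = 4/3` and
`1 + (2·3/(2π²))/(3/π²) = 2` [cite: BhargavaShankarTsimerman2012, §8.5 (proof of Cor. 7)]. The two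
inputs of that last step are named below — the count of quadratic fields (`fundDiscrs_card_asymp`)
and the first-order asymptotics of the sums (`davenportHeilbronn_threeTorsion_sum_asymp`, the two
previous displays combined: `Σ #Cl₃ = Σ 1 + 2 N(𝒱 ∩ V^{(i)}; X) ~ (3/π² + 6/(nᵢπ²)) X`) — and the
step itself is PROVED (`bst_threeTorsion_mean_holds_of`). The sum asymptotics are also the
`X`-coefficient of the stronger `btt_threeTorsion_sum` (`…_of_btt`, proved). -/

/-- NAMED FACT — **the number of quadratic fields of each sign with `|D| < X` is `~ 3X/π²`**
(Bhargava–Shankar–Tsimerman, §8.5: "Since it is known that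
`lim_{X→∞} Σ_{0<Disc(K₂)<X} 1 / X = 3/π²`, `lim_{X→∞} Σ_{-X<Disc(K₂)<0} 1 / X = 3/π²`"; classical,
from the density `6/π²` of squarefree integers distributed over the residue classes that define
fundamental discriminants). Along `X ∈ ℕ`, with the finsets `negFundDiscrs X`, `posFundDiscrs X` of
fundamental discriminants in `(-X, 0)`, `(0, X)`. Users take `(h : fundDiscrs_card_asymp)`.
[cite: BhargavaShankarTsimerman2012, §8.5 (display "Since it is known that", proof of Cor. 7)] -/
def fundDiscrs_card_asymp : Prop :=
  Tendsto (fun X : ℕ => ((negFundDiscrs X).card : ℝ) / X) atTop (𝓝 (3 / Real.pi ^ 2)) ∧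
  Tendsto (fun X : ℕ => ((posFundDiscrs X).card : ℝ) / X) atTop (𝓝 (3 / Real.pi ^ 2))

/-- NAMED FACT — **Davenport–Heilbronn, first-order asymptotics of the `3`-torsion sums**:
`Σ_{-X<D<0} #Cl₃(D) ~ (6/π²) X` and `Σ_{0<D<X} #Cl₃(D) ~ (4/π²) X` (`D` over fundamental
discriminants). In the printed proof of Cor. 7 (Bhargava–Shankar–Tsimerman §8.5) this is the
combination of the class-field-theory identity `Σ (h₃*(K₂) − 1)/2 = N(𝒱 ∩ V^{(i)}; X)` (nowhere
totally ramified cubic fields) with the sieved Davenport–Heilbronn count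
`N(𝒱 ∩ V^{(i)}; X)/X → 3/(nᵢπ²)` (`n₀ = 6`, `n₁ = 2`) and the count of quadratic fields:
`Σ #Cl₃ = Σ 1 + 2N ~ (3/π² + 6/(nᵢπ²)) X`, i.e. `4/π²` for `D > 0` and `6/π²` for `D < 0`
(Davenport–Heilbronn 1971, Thm. 3; the main terms of `btt_threeTorsion_sum`, from which it follows:
`davenportHeilbronn_threeTorsion_sum_asymp_of_btt`). Users take
`(h : davenportHeilbronn_threeTorsion_sum_asymp)`.
[cite: BhargavaShankarTsimerman2012, §8.5 (proof of Cor. 7)] [cite: DavenportHeilbronn1971, Thm 3] -/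
def davenportHeilbronn_threeTorsion_sum_asymp : Prop :=
  Tendsto (fun X : ℕ => (∑ D ∈ negFundDiscrs X, (quadFieldThreeTorsion D : ℝ)) / X)
    atTop (𝓝 (6 / Real.pi ^ 2)) ∧
  Tendsto (fun X : ℕ => (∑ D ∈ posFundDiscrs X, (quadFieldThreeTorsion D : ℝ)) / X)
    atTop (𝓝 (4 / Real.pi ^ 2))

/-- Ratio of two quantities with linear growth: if `s X / X → L` and `c X / X → M ≠ 0` then
`s X / c X → L / M` (along `X ∈ ℕ`). [folklore] -/
theorem tendsto_div_of_tendsto_div_natCast {s c : ℕ → ℝ} {L M : ℝ} (hM : M ≠ 0)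
    (hs : Tendsto (fun X : ℕ => s X / X) atTop (𝓝 L))
    (hc : Tendsto (fun X : ℕ => c X / X) atTop (𝓝 M)) :
    Tendsto (fun X : ℕ => s X / c X) atTop (𝓝 (L / M)) := by
  refine (hs.div hc hM).congr' ?_
  filter_upwards [eventually_gt_atTop 0] with X hX
  have hX : (X : ℝ) ≠ 0 := by exact_mod_cast hX.ne'
  simp only [Pi.div_apply]
  rw [div_div_div_cancel_right₀ hX]

/-- **Assembly (fact-decompose): BST Cor. 7 = `bst_threeTorsion_mean` from the count of quadratic
fields and the first-order sum asymptotics** — the last display of the printed proof: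
`(6/π²)/(3/π²) = 2` and `(4/π²)/(3/π²) = 4/3`.
[cite: BhargavaShankarTsimerman2012, §8.5 (proof of Cor. 7)] -/
theorem bst_threeTorsion_mean_holds_of (hN : fundDiscrs_card_asymp)
    (hS : davenportHeilbronn_threeTorsion_sum_asymp) : bst_threeTorsion_mean := by
  have hπ : (3 / Real.pi ^ 2 : ℝ) ≠ 0 := by positivity
  have hπ2 : (Real.pi ^ 2 : ℝ) ≠ 0 := by positivity
  refine ⟨?_, ?_⟩
  · have h := tendsto_div_of_tendsto_div_natCast hπ hS.1 hN.1
    have hval : (6 / Real.pi ^ 2) / (3 / Real.pi ^ 2) = (2 : ℝ) := by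
      rw [div_div_div_cancel_right₀ hπ2]; norm_num
    rwa [hval] at h
  · have h := tendsto_div_of_tendsto_div_natCast hπ hS.2 hN.2
    have hval : (4 / Real.pi ^ 2) / (3 / Real.pi ^ 2) = (4 / 3 : ℝ) := by
      rw [div_div_div_cancel_right₀ hπ2]
    rwa [hval] at h

/-- A two-term asymptotic with power saving gives the first-order limit: if
`|S X − c X − K X^{5/6}| ≤ C_ε X^{2/3+ε}` for all `X ≥ 1` (some `K`, every `ε > 0`), then
`S X / X → c`. [folklore] -/
theorem tendsto_div_natCast_of_twoTerm {S : ℕ → ℝ} {c : ℝ}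
    (h : ∃ K : ℝ, ∀ ε : ℝ, 0 < ε → ∃ C : ℝ, ∀ X : ℕ, 1 ≤ X →
      |S X - c * X - K * (X : ℝ) ^ ((5 : ℝ) / 6)| ≤ C * (X : ℝ) ^ ((2 : ℝ) / 3 + ε)) :
    Tendsto (fun X : ℕ => S X / X) atTop (𝓝 c) := by
  obtain ⟨K, hK⟩ := h
  obtain ⟨C, hC⟩ := hK (1 / 6) (by norm_num)
  -- the bound `|S X / X - c| ≤ (|K| + |C|) · X^{-1/6}` for `X ≥ 1`
  have key : ∀ X : ℕ, 1 ≤ X → ‖S X / X - c‖ ≤ (|K| + |C|) * (X : ℝ) ^ (-(1 / 6 : ℝ)) := by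
    intro X hX
    have hx : (1 : ℝ) ≤ X := by exact_mod_cast hX
    have hx0 : (0 : ℝ) < X := by linarith
    have h1 := hC X hX
    rw [show (2 : ℝ) / 3 + 1 / 6 = 5 / 6 by norm_num] at h1
    have hpow : 0 ≤ (X : ℝ) ^ ((5 : ℝ) / 6) := by positivity
    have hr : |S X - c * X| ≤ (|K| + |C|) * (X : ℝ) ^ ((5 : ℝ) / 6) := by
      have hsplit : S X - c * X =
          (S X - c * X - K * (X : ℝ) ^ ((5 : ℝ) / 6)) + K * (X : ℝ) ^ ((5 : ℝ) / 6) := by ring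
      calc |S X - c * X|
          = |(S X - c * X - K * (X : ℝ) ^ ((5 : ℝ) / 6)) + K * (X : ℝ) ^ ((5 : ℝ) / 6)| := by
            rw [← hsplit]
        _ ≤ |S X - c * X - K * (X : ℝ) ^ ((5 : ℝ) / 6)| + |K * (X : ℝ) ^ ((5 : ℝ) / 6)| :=
            abs_add_le _ _
        _ ≤ C * (X : ℝ) ^ ((5 : ℝ) / 6) + |K| * (X : ℝ) ^ ((5 : ℝ) / 6) := by
            rw [abs_mul, abs_of_nonneg hpow]
            exact add_le_add h1 le_rfl
        _ ≤ (|K| + |C|) * (X : ℝ) ^ ((5 : ℝ) / 6) := by nlinarith [le_abs_self C, hpow]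
    have hrew : S X / X - c = (S X - c * X) / X := by field_simp
    rw [Real.norm_eq_abs, hrew, abs_div, abs_of_pos hx0, div_le_iff₀ hx0]
    calc |S X - c * X| ≤ (|K| + |C|) * (X : ℝ) ^ ((5 : ℝ) / 6) := hr
      _ = (|K| + |C|) * (X : ℝ) ^ (-(1 / 6 : ℝ)) * X := by
          rw [mul_assoc, ← Real.rpow_add_one hx0.ne']
          norm_num
  -- `X^{-1/6} → 0`
  have hlim : Tendsto (fun X : ℕ => (|K| + |C|) * (X : ℝ) ^ (-(1 / 6 : ℝ))) atTop (𝓝 0) := by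
    have h0 : Tendsto (fun X : ℕ => (X : ℝ) ^ (-(1 / 6 : ℝ))) atTop (𝓝 0) :=
      (tendsto_rpow_neg_atTop (by norm_num : (0 : ℝ) < 1 / 6)).comp tendsto_natCast_atTop_atTop
    simpa using h0.const_mul (|K| + |C|)
  have hzero : Tendsto (fun X : ℕ => S X / X - c) atTop (𝓝 0) :=
    squeeze_zero_norm' (by
      filter_upwards [eventually_ge_atTop 1] with X hX
      exact key X hX) hlim
  have := hzero.add_const c
  simpa using this

/-- **The first-order sums from the two-term asymptotics**: `btt_threeTorsion_sum`
(Bhargava–Taniguchi–Thorne 2023, Thm. 1.2) implies `davenportHeilbronn_threeTorsion_sum_asymp` —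
so the latter is discharged as soon as the former is, and is independently the weaker, 1971,
statement. [cite: BhargavaTaniguchiThorne2023, Theorem 1.2] [cite: DavenportHeilbronn1971, Thm 3] -/
theorem davenportHeilbronn_threeTorsion_sum_asymp_of_btt (h : btt_threeTorsion_sum) :
    davenportHeilbronn_threeTorsion_sum_asymp := by
  refine ⟨tendsto_div_natCast_of_twoTerm ?_, tendsto_div_natCast_of_twoTerm ?_⟩
  · obtain ⟨K, hK⟩ := h.1
    refine ⟨K, fun ε hε => ?_⟩
    obtain ⟨C, hC⟩ := hK ε hε
    exact ⟨C, fun X hX => by simpa [mul_comm] using hC X hX⟩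
  · obtain ⟨K, hK⟩ := h.2
    refine ⟨K, fun ε hε => ?_⟩
    obtain ⟨C, hC⟩ := hK ε hε
    exact ⟨C, fun X hX => by simpa [mul_comm] using hC X hX⟩

end Literature.NumberTheory.QuadraticFields

end
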